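import Summits.QuantumFields.YangMills.Theorems.BalabanUVNodesN19LipschitzLinksTwoSidedLog
import Summits.QuantumFields.YangMills.Theorems.BalabanUVNodesN19SmoothLinkFirstOrderLocal
import Summits.QuantumFields.YangMills.Theorems.BalabanUVNodesN19ModulusLinkJacksonSmoothing

/-!
# YM-DAG node N19 (= NE7 proper) — THE MODULUS THEOREM: THE LOGARITHM MULTIPLIES ONLY THE OSCILLATION OF `h′` AT SCALE `d·log t∕t`
# (`dist_∞(h∘S_d, Π_t) ≤ 40·K·d∕t + 1.7·10⁵·μ·d·log₂t∕t` whenever `|h′(s) − h′(s′)| ≤ μ` for `s, s′ ∈ [0, d]`, `|s − s′| ≤ 7800·d·log₂t∕t`; `t ≥ 2^20`)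

Cell `pub-ymgap`, HUMAN RULING D-0062 (Track A) ∕ D-0149, R141 (C) seat `pub-ymgap-dag-n19-e` (s3 = ALTERNATIVE CURRENCY), generation g35,
module 9 (lineage module 193).  Route `Summits/QuantumFields/YangMills/Theses/BalabanUVNodes.lean`, cluster item K3⁸ «SpineGivenEndpointR13SepCoPHV»
(stmt-QuantumFields-27366); filed `--supports` that item `--as helper` (it proves no registered stub).  COUNT-NEUTRAL: [folklore]∕[bookkeeping] over the
lineage BY NAME — module 192 `…N19ModulusLinkJacksonSmoothing` (`exists_trigLink_near_modulusLink_jackson`), module 190 `…N19SmoothLinkFirstOrderLocal`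
(`exists_mvPolynomial_near_trigLink_firstOrder_local`), module 176 (`exists_parameters_log`, `logb_le20`), PART 2 (`exists_additiveJackson`), module 120
(`l1Norm_mem_Icc`), module 125 (`abs_integral_sub_integral_le_of_near`, `continuous_l1Norm`); no laws of the scheme, no scheme object, no Theses
import; NOT a discharge claim.

THE RESULT.  Module 176's budget (`L = ⌊t∕(5200log₂t)⌋`, `2π²L ≤ 2^J < 4π²L`, `h = ⌈3 log t⌉`, `N = ⌊3t∕8⌋`) run with module 192's smoothing of a `C¹` link
whose derivative oscillates by at most `μ` at scale `d∕L` (`≤ 7800·d·log₂t∕t`) and module 190's localised law (`R = μ·dπ∕2^J ≤ μd∕(2πL)`, as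
`dπ∕2^J ≤ d∕L`): smoothing `7π⁴dμ∕(32L) ≤ 166250·μ·d·log₂t∕t`, remainder `≤ 1242·μ·d·log₂t∕t`, first order + chord + ladder `≤ 40Kd∕t` (§1
`errorBound_modulus`).  ★★★ `exists_mvPolynomial_near_modulusLink_l1Norm`: for `h` with a continuous derivative `h′` everywhere, `|h′| ≤ K` on
`[0, d]`, `t ≥ 2^20`, and `|h′(s) − h′(s′)| ≤ μ` whenever `s, s′ ∈ [0, d]`, `|s − s′| ≤ 7800·d·log₂t∕t`:
**`|h(Σ_i|x_i|) − P(x)| ≤ 40·K·d∕t + 1.7·10⁵·μ·d·log₂t∕t`** for some `P ∈ Π_t`.  SPECIAL CASES: `μ = 2K` (any `C¹` link): module 176's row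
`≍ K·d·log₂t∕t`; `|h″| ≤ κ`: `μ = 7800κd·log₂t∕t` ⇒ `1.33·10⁹·κ·d²·log₂²t∕t²` (module 188's shape); `h′` Hölder or Dini-continuous (`μ·log₂t → 0`):
LOG-FREE.  READING (desk `numerics/OPEN-PROBLEM.md`): within this construction the logarithm of the general Lipschitz row is EXACTLY the price of an
`O(1)` oscillation of `h′` inside one window of length `≍ d·log t∕t` — a jump of `h′` (the hinge `|S_d − c|`) is the only candidate; whether a jump
genuinely costs `log t` (i.e. `dist_∞(|S_d − d∕2|, Π_t) ≍ d·log t∕t` or `≍ d∕t`) remains THE open row.  §2 the laws face.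

HONEST FRAMING (binding).  Elementary and [folklore]; ONE construction, constants astronomical; an UPPER bound only; NO consumer in the DAG today;
nothing of Bałaban's instantiated; NE7 NOT PRINTED, NOT proved; N19 NOT discharged; count-neutral.  One finite `T⁴` programme at fixed `ε`; nothing
continuum ∕ `ℝ⁴` ∕ OS ∕ mass-gap ∕ Clay.  0 `def` ∕ 0 `sorry`.
-/

noncomputable section

open Finset MeasureTheory
open scoped Real

namespace Summit.QuantumFields.YangMills.Theorems.BalabanUVNodesN19ModulusLinksDegreeBudget

open Summit.QuantumFields.YangMills.Theorems.BalabanUVNodesN19ModulusLinkJacksonSmoothing (exists_trigLink_near_modulusLink_jackson)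
open Summit.QuantumFields.YangMills.Theorems.BalabanUVNodesN19SmoothLinkFirstOrderLocal (exists_mvPolynomial_near_trigLink_firstOrder_local)
open Summit.QuantumFields.YangMills.Theorems.BalabanUVNodesN19LipschitzLinksDegreeBudgetLog (exists_parameters_log logb_le20)
open Summit.QuantumFields.YangMills.Theorems.BalabanUVNodesN19SingleModeL1Norm (exists_additiveJackson)
open Summit.QuantumFields.YangMills.Theorems.BalabanUVNodesN19OscillatingLinksMultiscale (l1Norm_mem_Icc)
open Summit.QuantumFields.YangMills.Theorems.BalabanUVNodesN19OscillatingLinksMomentDiscrepancy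
  (abs_integral_sub_integral_le_of_near continuous_l1Norm)

variable {ι : Type*} [Fintype ι]

/-! ## §1 The error budget [bookkeeping] -/

/-- THE ERROR BOOKKEEPING (module 176's parameters; module 192's smoothing `7π⁴dμ∕(32L)`, module 190's remainder `R = μ·dπ∕M`, `M = 2^J ≥ 2π²L`):
with `1∕L ≤ 7800Λ∕t` the two `μ` terms are `≤ 166250μdΛ∕t + 1242μdΛ∕t`; first order `2K·dπ∕N ≤ 8πKd∕t`, chord `K·dπ∕N ≤ 4πKd∕t`, ladder
`≤ Kd∕t`; total `≤ 40Kd∕t + 170000μdΛ∕t`. [bookkeeping] -/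
theorem errorBound_modulus {K μ d t Λ L M N ε : ℝ} (hK : 0 ≤ K) (hμ : 0 ≤ μ) (hd : 0 < d) (ht : 1048576 ≤ t) (hΛ : 20 ≤ Λ) (hL1 : 1 ≤ L)
    (hLt : 5200 * Λ * L ≤ t) (htL : t ≤ 7800 * Λ * L) (hM : 2 * L * π * π ≤ M) (hMN : M ≤ N) (hN4 : t / 4 ≤ N) (hε : ε ≤ 1 / (2 * t ^ 2)) :
    7 * π ^ 4 * d * μ / (32 * L) +
      (μ * (d * π / M) + 2 * K * (d * π / N) +
        ε * (π ^ 4 * (K * d) * L / 2) * (1 + 2 * L * π / d * (d * π / M + d * π / N))) + K * (d * (π / N)) ≤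
        40 * K * d / t + 170000 * μ * d * Λ / t := by
  have hπlo : 3.14 < π := Real.pi_gt_d2
  have hπhi : π < 3.15 := Real.pi_lt_d2
  have hπ := Real.pi_pos
  have ht0 : 0 < t := by linarith
  have hL0 : 0 < L := by linarith
  have hM0 : 0 < M := lt_of_lt_of_le (by positivity) hM
  have hN0 : 0 < N := lt_of_lt_of_le hM0 hMN
  have hKd : 0 ≤ K * d := mul_nonneg hK hd.le
  have hμd : 0 ≤ μ * d := mul_nonneg hμ hd.le
  have hΛ0 : 0 < Λ := by linarith
  have hinvL : 1 / L ≤ 7800 * Λ / t := by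
    rw [div_le_div_iff₀ hL0 ht0, one_mul]; exact htL
  -- smoothing
  have hπhi4 : π < 3.1416 := Real.pi_lt_d4
  have hπ2 : π ^ 2 < 3.1416 * 3.1416 := by rw [pow_two]; exact mul_lt_mul'' hπhi4 hπhi4 hπ.le hπ.le
  have hπ4 : π ^ 4 ≤ 97.42 := by nlinarith only [hπ2, pow_pos hπ 2]
  have hT1 : 7 * π ^ 4 * d * μ / (32 * L) ≤ 166250 * μ * d * Λ / t := by
    have e : 7 * π ^ 4 * d * μ / (32 * L) = μ * d * (7 * π ^ 4 / 32) * (1 / L) := by field_simp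
    rw [e]
    calc μ * d * (7 * π ^ 4 / 32) * (1 / L) ≤ μ * d * (7 * 97.42 / 32) * (7800 * Λ / t) :=
          mul_le_mul (mul_le_mul_of_nonneg_left (by linarith only [hπ4]) hμd) hinvL (by positivity) (by positivity)
      _ ≤ 166250 * μ * d * Λ / t := by
          rw [show μ * d * (7 * 97.42 / 32) * (7800 * Λ / t) = (7 * 97.42 / 32 * 7800) * (μ * d * Λ) / t by ring]
          exact div_le_div_of_nonneg_right (by nlinarith only [hμd, hΛ0]) ht0.le
  -- remainder (`M ≥ 2π²L`)
  have hT2 : μ * (d * π / M) ≤ 1242 * μ * d * Λ / t := by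
    have h1 : d * π / M ≤ d * π / (2 * L * π * π) := div_le_div_of_nonneg_left (by positivity) (by positivity) hM
    have e : d * π / (2 * L * π * π) = d / (2 * π) * (1 / L) := by field_simp
    have h2 : d / (2 * π) * (1 / L) ≤ d / (2 * π) * (7800 * Λ / t) := mul_le_mul_of_nonneg_left hinvL (by positivity)
    have h3 : d / (2 * π) * (7800 * Λ / t) ≤ 1242 * d * Λ / t := by
      rw [show d / (2 * π) * (7800 * Λ / t) = (7800 / (2 * π)) * (d * Λ) / t by field_simp,
        show 1242 * d * Λ / t = 1242 * (d * Λ) / t by ring]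
      refine div_le_div_of_nonneg_right (mul_le_mul_of_nonneg_right ?_ (by positivity)) ht0.le
      have hπlo4 : 3.1415 < π := Real.pi_gt_d4
      rw [div_le_iff₀ (by positivity)]; nlinarith only [hπlo4]
    calc μ * (d * π / M) ≤ μ * (1242 * d * Λ / t) := mul_le_mul_of_nonneg_left ((h1.trans e.le).trans (h2.trans h3)) hμ
      _ = 1242 * μ * d * Λ / t := by ring
  -- first order and chord
  have hdN : d * π / N ≤ 4 * π * d / t := by
    rw [div_le_div_iff₀ hN0 ht0]
    have e2 := mul_le_mul_of_nonneg_left hN4 (by positivity : (0 : ℝ) ≤ 4 * π * d)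
    have e3 : 4 * π * d * (t / 4) = d * π * t := by ring
    linarith only [e2, e3]
  have hT3 : 2 * K * (d * π / N) ≤ 8 * π * (K * d) / t := by
    calc 2 * K * (d * π / N) ≤ 2 * K * (4 * π * d / t) := mul_le_mul_of_nonneg_left hdN (by positivity)
      _ = 8 * π * (K * d) / t := by ring
  have hT5 : K * (d * (π / N)) ≤ 4 * π * (K * d) / t := by
    calc K * (d * (π / N)) = K * (d * π / N) := by ring
      _ ≤ K * (4 * π * d / t) := mul_le_mul_of_nonneg_left hdN hK
      _ = 4 * π * (K * d) / t := by ring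
  -- ladder
  have hT4 : ε * (π ^ 4 * (K * d) * L / 2) * (1 + 2 * L * π / d * (d * π / M + d * π / N)) ≤ K * d / t := by
    have h1 : 2 * L * π / d * (d * π / M) ≤ 1 := by
      rw [show 2 * L * π / d * (d * π / M) = 2 * L * π * π / M by field_simp, div_le_one hM0]; exact hM
    have h2 : 2 * L * π / d * (d * π / N) ≤ 1 := by
      rw [show 2 * L * π / d * (d * π / N) = 2 * L * π * π / N by field_simp, div_le_one hN0]; exact hM.trans hMN
    have h3 : 1 + 2 * L * π / d * (d * π / M + d * π / N) ≤ 3 := by rw [mul_add]; linarith only [h1, h2]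
    have hW : π ^ 4 * (K * d) * L / 2 ≤ 49.25 * (K * d) * L := by
      rw [div_le_iff₀ (by norm_num : (0 : ℝ) < 2)]
      have := mul_le_mul_of_nonneg_right hπ4 (by positivity : (0 : ℝ) ≤ K * d * L)
      have h0 : 0 ≤ K * d * L := by positivity
      nlinarith only [this, h0]
    have h03 : (0 : ℝ) ≤ 1 + 2 * L * π / d * (d * π / M + d * π / N) := by positivity
    have h4 : ε * (π ^ 4 * (K * d) * L / 2) * (1 + 2 * L * π / d * (d * π / M + d * π / N)) ≤
        (1 / (2 * t ^ 2)) * (49.25 * (K * d) * L) * 3 :=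
      mul_le_mul (mul_le_mul hε hW (by positivity) (by positivity)) h3 h03 (by positivity)
    refine h4.trans ?_
    rw [show 1 / (2 * t ^ 2) * (49.25 * (K * d) * L) * 3 = 73.875 * K * d * L / t ^ 2 by field_simp; ring,
      div_le_div_iff₀ (by positivity) ht0]
    have hLsmall : 104000 * L ≤ t := by nlinarith only [hLt, hΛ, hL0]
    have := mul_le_mul_of_nonneg_left hLsmall (by positivity : (0 : ℝ) ≤ K * d * t)
    nlinarith only [this, hKd, ht0, hL0]
  have hsum : 166250 * μ * d * Λ / t + (1242 * μ * d * Λ / t + 8 * π * (K * d) / t + K * d / t) + 4 * π * (K * d) / t ≤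
      40 * K * d / t + 170000 * μ * d * Λ / t := by
    have e1 : 8 * π * (K * d) / t + K * d / t + 4 * π * (K * d) / t ≤ 40 * K * d / t := by
      rw [← add_div, ← add_div]
      refine div_le_div_of_nonneg_right ?_ ht0.le
      nlinarith only [hπhi, hKd]
    have e2 : 166250 * μ * d * Λ / t + 1242 * μ * d * Λ / t ≤ 170000 * μ * d * Λ / t := by
      rw [← add_div]
      exact div_le_div_of_nonneg_right (by nlinarith only [hμd, hΛ0]) ht0.le
    linarith only [e1, e2]
  linarith only [hT1, hT2, hT3, hT4, hT5, hsum]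

/-! ## §2 ★★★ The modulus theorem [folklore] -/

variable [Nonempty ι]

/-- ★★★ **THE MODULUS THEOREM — the logarithm multiplies only the oscillation of `h′` at scale `d·log t∕t`.**  For finite nonempty `ι` (`d = |ι|`),
`h : ℝ → ℝ` with a continuous derivative `h′` everywhere, `|h′| ≤ K` on `[0, d]`, `t ≥ 2^20`, and a number `μ` with `|h′(s) − h′(s′)| ≤ μ` whenever
`s, s′ ∈ [0, d]` and `|s − s′| ≤ 7800·d·log₂t∕t`: there is `P : MvPolynomial ι ℝ` of total degree `≤ t` with
**`|h(Σ_i|x_i|) − P(x)| ≤ 40·K·d∕t + 1.7·10⁵·μ·d·log₂t∕t`** on `[−1,1]^ι`.  (`μ = 2K`: module 176's Lipschitz row up to the constant; `|h″| ≤ κ`: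
`μ = 7800κd·log₂t∕t`, module 188's `C²` shape; Hölder∕Dini `h′`: LOG-FREE; the hinge: `h′` jumps, `μ = 2` at every scale — the open row.) [folklore] -/
theorem exists_mvPolynomial_near_modulusLink_l1Norm {h h' : ℝ → ℝ} (hh : ∀ s, HasDerivAt h (h' s) s) (hh'c : Continuous h')
    {K μ : ℝ} (hK : ∀ s ∈ Set.Icc (0 : ℝ) (Fintype.card ι), |h' s| ≤ K) {t : ℕ} (ht : 2 ^ 20 ≤ t)
    (hμ : ∀ s s', s ∈ Set.Icc (0 : ℝ) (Fintype.card ι) → s' ∈ Set.Icc (0 : ℝ) (Fintype.card ι) →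
      |s - s'| ≤ 7800 * Fintype.card ι * Real.logb 2 t / t → |h' s - h' s'| ≤ μ) :
    ∃ P : MvPolynomial ι ℝ, P.totalDegree ≤ t ∧
      ∀ x : ι → ℝ, (∀ i, x i ∈ Set.Icc (-1 : ℝ) 1) →
        |h (∑ i, |x i|) - MvPolynomial.eval x P| ≤ 40 * K * Fintype.card ι / t + 170000 * μ * Fintype.card ι * Real.logb 2 t / t := by
  set d : ℝ := (Fintype.card ι : ℝ) with hdd
  have hd : 0 < d := by rw [hdd]; exact_mod_cast Fintype.card_pos
  have ht0 : (0 : ℝ) < t := by exact_mod_cast (show 0 < t by omega)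
  have htr : (1048576 : ℝ) ≤ t := by exact_mod_cast ht
  have h0mem : (0 : ℝ) ∈ Set.Icc (0 : ℝ) d := ⟨le_rfl, hd.le⟩
  have hK0 : 0 ≤ K := (abs_nonneg _).trans (hK 0 h0mem)
  obtain ⟨hΛ20, hΛlin⟩ := logb_le20 ht
  have hwin0 : 0 ≤ 7800 * d * Real.logb 2 t / t := div_nonneg (mul_nonneg (mul_nonneg (by norm_num) hd.le) (by linarith)) ht0.le
  have hμ0 : 0 ≤ μ := (abs_nonneg _).trans (hμ 0 0 h0mem h0mem (by rw [sub_self, abs_zero]; exact hwin0))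
  obtain ⟨L, J, hh₀, N, hL1, htL, hLt, hh1, hJh, hexph, hJ1, hLππ, hNJ, _hM4, hN4, hdeg⟩ := exists_parameters_log ht
  have hLr : (1 : ℝ) ≤ L := by exact_mod_cast hL1
  have hL0 : (0 : ℝ) < L := by linarith
  -- the modulus at scale `d/L ≤ 7800·d·log₂t/t`
  have hinvL : 1 / (L : ℝ) ≤ 7800 * Real.logb 2 t / t := by rw [div_le_div_iff₀ hL0 ht0, one_mul]; exact htL
  have hdL : d / L ≤ 7800 * d * Real.logb 2 t / t := by
    calc d / L = d * (1 / L) := by ring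
      _ ≤ d * (7800 * Real.logb 2 t / t) := mul_le_mul_of_nonneg_left hinvL hd.le
      _ = 7800 * d * Real.logb 2 t / t := by ring
  have hμL : ∀ s s', s ∈ Set.Icc (0 : ℝ) d → s' ∈ Set.Icc (0 : ℝ) d → |s - s'| ≤ d / L → |h' s - h' s'| ≤ μ :=
    fun s s' hs hs' hss' => hμ s s' hs hs' (hss'.trans hdL)
  obtain ⟨α, β, ω, g, g₁, hω0, hωΩ, hW, hg, hg₁, hC1, hB1, hlam, herr⟩ := exists_trigLink_near_modulusLink_jackson hd hh hh'c hK hL1 hμL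
  have hΩ : (0 : ℝ) ≤ 2 * L * π / d := by positivity
  -- the localised remainder at scale `dπ/2^J ≤ d/L`
  have h2J : (0 : ℝ) < 2 ^ J := by positivity
  have hscale : d * π / 2 ^ J ≤ d / L := by
    rw [div_le_div_iff₀ h2J hL0]
    have h1 : π ≤ 2 * π * π := by nlinarith only [Real.pi_gt_three]
    calc d * π * L = (d * L) * π := by ring
      _ ≤ (d * L) * (2 * π * π) := mul_le_mul_of_nonneg_left h1 (by positivity)
      _ = d * (2 * L * π * π) := by ring
      _ ≤ d * 2 ^ J := mul_le_mul_of_nonneg_left hLππ hd.le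
  have hC11 : ∀ u a, |u - a| ≤ Fintype.card ι * π / 2 ^ J → |g u - g a - g₁ a * (u - a)| ≤ μ * (d * π / 2 ^ J) := by
    intro u a hua
    rw [← hdd] at hua
    exact (hC1 u a (hua.trans hscale)).trans (mul_le_mul_of_nonneg_left hua hμ0)
  obtain ⟨P₀, hP₀deg, hP₀err⟩ := exists_mvPolynomial_near_trigLink_firstOrder_local (ι := ι)
    (((range L ×ˢ range L) ×ˢ (range L ×ˢ range L)) ×ˢ (Finset.univ : Finset Bool)) 0 α β ω
    (Ω := 2 * L * π / d) (W := π ^ 4 * (K * d) * L / 2) (B₁ := 2 * K) hg hg₁ hΩ hω0 hωΩ hW hB1 J hh₀ N hh1 hJh hNJ hC11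
  have hNpos : 0 < N := by
    have h1 : (0 : ℝ) < N := lt_of_lt_of_le (by positivity) hN4
    exact_mod_cast h1
  obtain ⟨A, hAdeg, hAerr⟩ := exists_additiveJackson (ι := ι) hNpos
  have h2N : 2 * N ≤ t := by
    have h1 : (2 : ℝ) * N ≤ t := by
      have h2 : 0 ≤ 2 * Real.exp 2 * (2 * L * π) * (1 / 2 + π + 3 * π * J) + 2 * hh₀ * (2 ^ (J + 1) - 1) := by
        have : (1 : ℝ) ≤ 2 ^ (J + 1) := one_le_pow₀ (by norm_num)
        have h3 : (0 : ℝ) ≤ 2 ^ (J + 1) - 1 := by linarith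
        positivity
      linarith only [hdeg, h2]
    exact_mod_cast h1
  refine ⟨MvPolynomial.C (h 0) + MvPolynomial.C ((h d - h 0) / d) * A + P₀, ?_, fun x hx => ?_⟩
  · have e : 2 * Real.exp 2 * (2 * L * π / d) * (Fintype.card ι : ℝ) * (1 / 2 + π + 3 * π * J) =
        2 * Real.exp 2 * (2 * L * π) * (1 / 2 + π + 3 * π * J) := by rw [← hdd]; field_simp
    rw [e] at hP₀deg
    have hP₀ : P₀.totalDegree ≤ t := Nat.cast_le.1 (hP₀deg.trans hdeg)
    refine (MvPolynomial.totalDegree_add _ _).trans (max_le ((MvPolynomial.totalDegree_add _ _).trans (max_le ?_ ?_)) hP₀)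
    · rw [MvPolynomial.totalDegree_C]; exact Nat.zero_le _
    · exact (MvPolynomial.totalDegree_mul _ _).trans (by rw [MvPolynomial.totalDegree_C, zero_add]; exact hAdeg.trans h2N)
  · have hS := l1Norm_mem_Icc x hx
    rw [← hdd] at hS hP₀err hAerr
    have h1 := herr (∑ i, |x i|) ⟨hS.1, hS.2⟩
    have h2 := hP₀err x hx
    have h3 := hAerr x hx
    have hε : 2 * ((J : ℝ) + 1) * Real.exp (-(hh₀ : ℝ)) ≤ 1 / (2 * t ^ 2) := by
      calc 2 * ((J : ℝ) + 1) * Real.exp (-(hh₀ : ℝ)) ≤ 2 * (t / 4) * (1 / t ^ 3) := by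
            have := mul_le_mul hJ1 hexph (Real.exp_pos _).le (by positivity)
            linarith only [this]
        _ = 1 / (2 * t ^ 2) := by field_simp; ring
    have hNJr : ((2 : ℝ) ^ J) ≤ N := by exact_mod_cast hNJ
    have key := errorBound_modulus (M := (2 : ℝ) ^ J) (ε := 2 * ((J : ℝ) + 1) * Real.exp (-(hh₀ : ℝ))) hK0 hμ0 hd htr hΛ20 hLr hLt htL
      hLππ hNJr hN4 hε
    have hchord : |(h d - h 0) / d * (∑ i, |x i|) - (h d - h 0) / d * MvPolynomial.eval x A| ≤ K * (d * (π / N)) := by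
      rw [← mul_sub, abs_mul]
      exact mul_le_mul hlam h3 (abs_nonneg _) hK0
    have hev : MvPolynomial.eval x (MvPolynomial.C (h 0) + MvPolynomial.C ((h d - h 0) / d) * A + P₀) =
        h 0 + (h d - h 0) / d * MvPolynomial.eval x A + MvPolynomial.eval x P₀ := by
      simp only [map_add, map_mul, MvPolynomial.eval_C]
    rw [hev]
    have esplit : h (∑ i, |x i|) - (h 0 + (h d - h 0) / d * MvPolynomial.eval x A + MvPolynomial.eval x P₀) =
        (h (∑ i, |x i|) - h 0 - (h d - h 0) / d * (∑ i, |x i|) - g (∑ i, |x i|)) +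
          ((h d - h 0) / d * (∑ i, |x i|) - (h d - h 0) / d * MvPolynomial.eval x A) + (g (∑ i, |x i|) - MvPolynomial.eval x P₀) := by ring
    rw [esplit]
    calc |(h (∑ i, |x i|) - h 0 - (h d - h 0) / d * (∑ i, |x i|) - g (∑ i, |x i|)) +
          ((h d - h 0) / d * (∑ i, |x i|) - (h d - h 0) / d * MvPolynomial.eval x A) + (g (∑ i, |x i|) - MvPolynomial.eval x P₀)|
        ≤ |h (∑ i, |x i|) - h 0 - (h d - h 0) / d * (∑ i, |x i|) - g (∑ i, |x i|)| +
          |(h d - h 0) / d * (∑ i, |x i|) - (h d - h 0) / d * MvPolynomial.eval x A| + |g (∑ i, |x i|) - MvPolynomial.eval x P₀| :=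
          (abs_add_le _ _).trans (add_le_add (abs_add_le _ _) le_rfl)
      _ ≤ 7 * π ^ 4 * d * μ / (32 * L) + K * (d * (π / N)) +
          (μ * (d * π / 2 ^ J) + 2 * K * (d * π / N) +
            2 * ((J : ℝ) + 1) * Real.exp (-(hh₀ : ℝ)) * (π ^ 4 * (K * d) * L / 2) *
              (1 + 2 * L * π / d * (d * π / 2 ^ J + d * π / N))) := add_le_add (add_le_add h1 hchord) h2
      _ ≤ 40 * K * d / t + 170000 * μ * d * Real.logb 2 t / t := by linarith only [key]

/-- ★★ **THE LAWS FACE OF THE MODULUS THEOREM.**  `P, Q` probability laws on `ℝ^ι` carried by `[−1,1]^ι` with equal mixed moments of total degree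
`≤ t` (`t ≥ 2^20`); `h` as in `exists_mvPolynomial_near_modulusLink_l1Norm`.  Then
`|∫h(Σ|x_i|)dP − ∫h(Σ|x_i|)dQ| ≤ 2·(40·K·d∕t + 1.7·10⁵·μ·d·log₂t∕t)`. [folklore] -/
theorem abs_integral_modulusLink_l1Norm_sub_le_of_moments {P Q : Measure (ι → ℝ)} [IsProbabilityMeasure P] [IsProbabilityMeasure Q]
    (hP : P (Set.pi Set.univ (fun _ : ι => Set.Icc (-1 : ℝ) 1))ᶜ = 0) (hQ : Q (Set.pi Set.univ (fun _ : ι => Set.Icc (-1 : ℝ) 1))ᶜ = 0)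
    {t : ℕ} (ht : 2 ^ 20 ≤ t) (hmom : ∀ j : ι → ℕ, ∑ i, j i ≤ t → ∫ x, ∏ i, x i ^ j i ∂P = ∫ x, ∏ i, x i ^ j i ∂Q)
    {h h' : ℝ → ℝ} (hh : ∀ s, HasDerivAt h (h' s) s) (hh'c : Continuous h')
    {K μ : ℝ} (hK : ∀ s ∈ Set.Icc (0 : ℝ) (Fintype.card ι), |h' s| ≤ K)
    (hμ : ∀ s s', s ∈ Set.Icc (0 : ℝ) (Fintype.card ι) → s' ∈ Set.Icc (0 : ℝ) (Fintype.card ι) →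
      |s - s'| ≤ 7800 * Fintype.card ι * Real.logb 2 t / t → |h' s - h' s'| ≤ μ) :
    |∫ x, h (∑ i, |x i|) ∂P - ∫ x, h (∑ i, |x i|) ∂Q| ≤
      2 * (40 * K * Fintype.card ι / t + 170000 * μ * Fintype.card ι * Real.logb 2 t / t) := by
  obtain ⟨F, hF, happ⟩ := exists_mvPolynomial_near_modulusLink_l1Norm (ι := ι) hh hh'c hK ht hμ
  have hc : Continuous h := continuous_iff_continuousAt.2 fun s => (hh s).continuousAt
  exact abs_integral_sub_integral_le_of_near hP hQ hmom (hc.comp continuous_l1Norm) hF happ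

end Summit.QuantumFields.YangMills.Theorems.BalabanUVNodesN19ModulusLinksDegreeBudget

end
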